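/-
Copyright: cell `pub-ymgap` (HUMAN RULING D-0062), Track A of `YM-PLAN.md`, DAG node N20 (= NE7b); R134 acceleration seat
`pub-ymgap-dag-n20-c` (strategy s1, generation 4), module 22.  Released under the licence of the surrounding project.
-/
import Summits.QuantumFields.YangMills.Theorems.BalabanUVNodesN20LCSLabelPieces
import Summits.QuantumFields.YangMills.Theorems.BalabanUVNodesN20LCSAvgTransfer
import HarnessLib

/-!
# YM-DAG node N20 (= NE7b), strategy s1, module 22: «LCS-j» IN THE OLD TERM's OWN STATE ⇒ «hrel» FOR THE PINNED (3.2) FAMILIES AT STEP j —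
# the two located halves COMPOSE AT EVERY LEVEL (one Peierls factor per pinned cube from local exponential plaquette moments of the term's state)

Track A of `YM-PLAN.md` (cell `pub-ymgap`, HUMAN RULING D-0062), node **N20** = spine estimate NE7b (`T4WeightBudget.RelWeightBound` — NOT PRINTED,
NOT PROVED).  Seat `pub-ymgap-dag-n20-c` (R134, s1), generation 4, module 22 (17–21 = `…N20LCSLargeField{Labels,FirstStep,Families,Halves}`,
`…N20LCSLabelPieces`).  Kernel theorems only: 0 `def`, 0 `sorry`, standard axioms; COUNT-NEUTRAL; `--supports` the K3‴ item.  Nothing of Bałaban's is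
asserted.

WHY.  Modules 18–21 close the pinned (3.2) label event at the FIRST step, where the old term's state is `ρ₀` and its local exponential plaquette moments are
generation 2's module 7.  At a step `j ≥ 1` the old term's fine density `f` is dressed (module 3: `χ_j(Ū)·w(U,Ū)·…`), and the moment bound in ITS OWN
state — «LCS-j», `Spine/NE7b/LocalConditionalStability.LocCondStability` with exponential plaquette-energy carriers — is THE located residual of
Bałaban's kind ((A1c); generation 3's modules 12–15 give it for the all-plaquette-restricted level-`0` state).  THIS FILE proves that this residual is
ALL the pinned (3.2) labels need at step `j`: the two halves COMPOSE at every level.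
* §1 ★ **`setIntegral_forall_exists_le_of_moments`** (generic level `j`, any measurable integrable `f ≥ 0` on the level-`j` fields of a `d = 4`-free
  parameter set, `j + 1 ≤ m + K`): the un-normalised moment bound `∫ e^{aβΣ_{q∈X}(1 − reTr U(∂q))}·f dU ≤ e^{C·a·#X}·∫f dU` (`0 ≤ a ≤ a₀`) gives, for
  pairwise disjoint cells `R c` of `≤ m` level-`(j+1)` plaquettes, `∫_{∀ c∈D, ∃ p′∈R c, ε ≤ 1 − reTr Ū(∂p′)} f dU ≤ (m·e^{C·A·M·M·δ − δβε})^{#D}·∫ f dU`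
  — n20-d's TRANSFER RULE `N20LCSAvgTransfer.measureReal_largeFieldCells_avgFun_le_of_moments` applied to the probability measure `(∫f)⁻¹·f·dU`
  (`withDensity` bookkeeping: it IS a probability measure, its integrals are `(∫f)⁻¹∫ ·f`, its mass of the event is `(∫f)⁻¹∫_{event} f`; the
  degenerate state `∫f = 0` apart); `A`, `M` n20-d's domination ∕ multiplicity constants, `δ` its tilt under the guard `α`.
* §2 ★★★ **`abs_integral_pinnedLargeFamily_le_of_moments`** (at the record, any performed step `k < K`): modulo `IsZetaAbsLeOne` and the regularity
  letters of the pinned cubes (disjoint regions, common size threshold `ε″ ≥ 0`), «LCS-k» in the old term's state `f` in the moment form above IMPLIES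
  `|∫ (Σ_{t : D ⊆ P(t)} ω s t (U,Ū))·f dU| ≤ (m·e^{C·A·M·M·δ − δβ·ε″²∕(2N)})^{#D}·∫ f dU` — module 19's graph step, the size-to-energy inclusion
  (`sq_div_le_one_sub_reTr_of_le_dist1`), §1.  So what the (A1c) instance owes at `j ≥ 1` FOR THE (3.2)-PINNED LABELS is EXACTLY «LCS-j» for the term's
  fine density, by name; at `j = 0`, `f = ρ₀`, it is module 7 and §2 re-derives module 19's first-step bound up to constants.
* §3 **`abs_sum_integral_pinnedLabelPieces_le_of_moments`** — the same IN THE TOWER's CURRENCY (module 21): at any performed step, from «LCS-k» for the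
  old piece `χ_k(s)·T(s)`, the level-`(k+1)` masses of the pinned label pieces sum to at most `(m·r)^{#D}` times the old piece's mass —
  `PrefixExtraction.hrel_of_hstep`'s conclusion shape at level `k`, CONDITIONAL on the located residual.

HONEST FRAMING.  An IMPLICATION at every level, not an estimate at any level `j ≥ 1`: the hypothesis `hLS` there is the located residual (the dressed
states of module 3 are not reflection-symmetric products of one-plaquette factors — generation 3's §2c), NOT discharged here; two displayed letters;
label-indexed reading; disjoint letter regions; the (3.3) labels, the collar labels and the inherited region are NOT extracted.  NE7b NOT PRINTED ∕ NOT
PROVED; (α)-instance 0∕1; N20 NOT discharged; typed 28∕28, discharged count untouched; one finite four-torus at fixed `ε` — NOT ℝ⁴, NOT infinite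
volume, NOT OS, NOT a mass gap, NOT Clay.

References: T. Bałaban, CMP 119 (1988) 243–285 [Balaban1988Convergent] ((3.2) p. 265); CMP 122 (1989) 175–202 [Balaban1989LargeFieldI] ((0.1),
(0.3)–(0.5) pp. 175–177); CMP 122 (1989) 355–392 [Balaban1989LargeFieldII] (p. 383 l. 21–28, (1.79)–(1.80)); CMP 98 (1985) 17–51
[Balaban1985Averaging] (Prop. 1 (51) p. 26); CMP 99 (1985) 389–434 [Balaban1985PropagatorsII] (Thm 1).
-/

set_option autoImplicit false

noncomputable section

open scoped BigOperators

namespace Summit.QuantumFields.YangMills.BalabanUVNodes.N20LCSLargeFieldOfMoments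

open MeasureTheory
open Literature.MathematicalPhysics.QuantumFieldTheory.Balaban1983to89
open Literature.MathematicalPhysics.QuantumFieldTheory.Balaban1983to89.T4Continuum
open Literature.MathematicalPhysics.QuantumFieldTheory.Balaban1983to89.Node00
open BlockAveraging (avgFun measurable_avgFun)
open ExpMeanLog (expMeanLogSU deltaSU measurable_expMeanLogSU_E)
open Summit.QuantumFields.YangMills.BalabanUVNodes.N20LCSAvgTransfer (measureReal_largeFieldCells_avgFun_le_of_moments)
open Summit.QuantumFields.YangMills.BalabanUVNodes.N20LCSAvgExpMoment (sq_div_le_one_sub_reTr_of_le_dist1)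
open Summit.QuantumFields.YangMills.BalabanUVNodes.N20LCSLargeFieldFamilies
  (abs_integral_sum_ωOfRecord_filter_superset_mul_le measurableSet_forall_exists_largeField)
open Summit.QuantumFields.YangMills.BalabanUVNodes.N20LCSLabelPieces (integral_labelPiece integrable_labelFine)

/-! ## §1 The normalised state of a non-negative fine density: un-normalised moment bounds feed n20-d's transfer rule -/

section State

variable {N : ℕ} [NeZero N] {P : Params} {j : ℕ}

/-- **THE `f`-MASS OF THE SIMULTANEOUS COARSE LARGE-FIELD EVENT FROM MOMENTS IN THE STATE `f`.**  Let `f ≥ 0` be a measurable integrable density on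
the level-`j` fields (`j + 1 ≤ m + K`) whose state has LOCAL EXPONENTIAL PLAQUETTE MOMENTS in the un-normalised form of `LocCondStability`:
`∫ e^{aβΣ_{q∈X}(1 − reTr U(∂q))}·f dU ≤ e^{C·a·#X}·∫ f dU` for `0 ≤ a ≤ a₀` and every finite `X` (`hLS`).  Then, with n20-d's transfer constants
(guard `α`, tilt `δ`), for every finite family `D` with pairwise disjoint cells `R c` of at most `m` level-`(j+1)` plaquettes and every energy threshold `ε`,
`∫_{∀ c∈D, ∃ p′∈R c, ε ≤ 1 − reTr Ū(∂p′)} f dU ≤ (m·e^{C·A·M·M·δ − δβε})^{#D} · ∫ f dU` (`A`, `M` n20-d's domination and multiplicity constants) —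
`N20LCSAvgTransfer.measureReal_largeFieldCells_avgFun_le_of_moments` for the probability measure `(∫f)⁻¹·f·dU`. [folklore] -/
theorem setIntegral_forall_exists_le_of_moments (hj : j + 1 ≤ P.m + P.K) {α : ℝ} (hα : 0 < α)
    (hguard : ((((P.d + 2) * P.L : ℕ) : ℝ) ^ 2 / 4) * Real.sqrt (2 * (Fintype.card (Fin N) : ℝ) * α) < deltaSU (Fin N))
    {f : GaugeField P j (Matrix.specialUnitaryGroup (Fin N) ℂ) → ℝ} (hfm : Measurable f) (hf0 : ∀ U, 0 ≤ f U)
    (hf : Integrable f (fieldMeasure P j (Matrix.specialUnitaryGroup (Fin N) ℂ))) {β : ℝ} (hβ : 0 ≤ β) {C a₀ : ℝ} (hC : 0 ≤ C)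
    (hLS : ∀ a : ℝ, 0 ≤ a → a ≤ a₀ → ∀ X : Finset (Plaq P j),
      ∫ U, Real.exp (a * β * ∑ q ∈ X, (1 - reTr (GaugeField.plaqHol U q))) * f U
          ∂(fieldMeasure P j (Matrix.specialUnitaryGroup (Fin N) ℂ)) ≤
        Real.exp (C * a * X.card) * ∫ U, f U ∂(fieldMeasure P j (Matrix.specialUnitaryGroup (Fin N) ℂ)))
    {δ : ℝ} (hδ0 : 0 ≤ δ)
    (hδ : δ * ((2 * (Fintype.card (Fin N) : ℝ) * ((P.L : ℝ) ^ 2 + 6 * (((P.d + 2) * P.L : ℕ) : ℝ) ^ 2) ^ 2 + 2 / α) *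
      (((2 * ((P.d + 3) * P.L + 2) + 1) ^ P.d * P.d ^ 2 : ℕ) : ℝ)) ≤ a₀)
    (ε : ℝ) {κ : Type*} [DecidableEq κ] (D : Finset κ) (R : κ → Finset (Plaq P (j + 1))) (m : ℕ)
    (hm : ∀ c ∈ D, (R c).card ≤ m) (hdisj : ∀ c₁ ∈ D, ∀ c₂ ∈ D, c₁ ≠ c₂ → Disjoint (R c₁) (R c₂)) :
    ∫ U in {U | ∀ c ∈ D, ∃ p' ∈ R c, ε ≤ 1 - reTr (GaugeField.plaqHol (avgFun (expMeanLogSU (n := Fin N)) U) p')}, f U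
        ∂(fieldMeasure P j (Matrix.specialUnitaryGroup (Fin N) ℂ)) ≤
      ((m : ℝ) * Real.exp (C * ((2 * (Fintype.card (Fin N) : ℝ) * ((P.L : ℝ) ^ 2 + 6 * (((P.d + 2) * P.L : ℕ) : ℝ) ^ 2) ^ 2 + 2 / α) *
          (((2 * ((P.d + 3) * P.L + 2) + 1) ^ P.d * P.d ^ 2 : ℕ) : ℝ)) *
          (((2 * ((P.d + 3) * P.L + 2) + 1) ^ P.d * P.d ^ 2 : ℕ) : ℝ) * δ - δ * β * ε)) ^ D.card *
        ∫ U, f U ∂(fieldMeasure P j (Matrix.specialUnitaryGroup (Fin N) ℂ)) := by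
  classical
  set μ : Measure (GaugeField P j (Matrix.specialUnitaryGroup (Fin N) ℂ)) := fieldMeasure P j (Matrix.specialUnitaryGroup (Fin N) ℂ)
    with hμ
  set S : Set (GaugeField P j (Matrix.specialUnitaryGroup (Fin N) ℂ)) :=
    {U | ∀ c ∈ D, ∃ p' ∈ R c, ε ≤ 1 - reTr (GaugeField.plaqHol (avgFun (expMeanLogSU (n := Fin N)) U) p')} with hS
  set Z : ℝ := ∫ U, f U ∂μ with hZ
  set r : ℝ := ((m : ℝ) * Real.exp (C * ((2 * (Fintype.card (Fin N) : ℝ) * ((P.L : ℝ) ^ 2 + 6 * (((P.d + 2) * P.L : ℕ) : ℝ) ^ 2) ^ 2 + 2 / α) *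
          (((2 * ((P.d + 3) * P.L + 2) + 1) ^ P.d * P.d ^ 2 : ℕ) : ℝ)) *
          (((2 * ((P.d + 3) * P.L + 2) + 1) ^ P.d * P.d ^ 2 : ℕ) : ℝ) * δ - δ * β * ε)) ^ D.card with hr
  have hr0 : 0 ≤ r := pow_nonneg (mul_nonneg (Nat.cast_nonneg _) (Real.exp_pos _).le) _
  have hZ0 : 0 ≤ Z := integral_nonneg hf0
  -- the measurable event
  have hSm : MeasurableSet S := by
    have : S = ⋂ c ∈ D, ⋃ p' ∈ R c, {U : GaugeField P j (Matrix.specialUnitaryGroup (Fin N) ℂ) |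
        ε ≤ 1 - reTr (GaugeField.plaqHol (avgFun (expMeanLogSU (n := Fin N)) U) p')} := by
      ext U; simp [hS]
    rw [this]
    refine Finset.measurableSet_biInter D fun c _ => Finset.measurableSet_biUnion (R c) fun p' _ => ?_
    exact measurableSet_le measurable_const ((measurable_const.sub
      (RegularGaugeGroup.measurable_reTr.comp (Missing.measurable_plaqHol p'))).comp
        (measurable_avgFun (expMeanLogSU (n := Fin N)) measurable_expMeanLogSU_E))
  by_cases hZpos : Z = 0
  · -- degenerate state: `f = 0` a.e., both sides vanish
    have hle : ∫ U in S, f U ∂μ ≤ Z := setIntegral_le_integral hf (ae_of_all _ hf0)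
    calc ∫ U in S, f U ∂μ ≤ Z := hle
      _ = r * Z := by rw [hZpos, mul_zero]
  have hZp : 0 < Z := lt_of_le_of_ne hZ0 (Ne.symm hZpos)
  -- the normalised state `ν = Z⁻¹·f·dU`
  set Fd : GaugeField P j (Matrix.specialUnitaryGroup (Fin N) ℂ) → ENNReal := fun U => ENNReal.ofReal (f U) with hFd
  have hFdm : Measurable Fd := ENNReal.measurable_ofReal.comp hfm
  have hlint : ∫⁻ U, Fd U ∂μ = ENNReal.ofReal Z := by
    rw [hZ, ofReal_integral_eq_lintegral_ofReal hf (ae_of_all _ hf0)]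
  set ν : Measure (GaugeField P j (Matrix.specialUnitaryGroup (Fin N) ℂ)) := (ENNReal.ofReal Z)⁻¹ • μ.withDensity Fd with hν
  have hZne : ENNReal.ofReal Z ≠ 0 := (ENNReal.ofReal_pos.mpr hZp).ne'
  haveI : IsProbabilityMeasure ν := by
    refine ⟨?_⟩
    rw [hν, Measure.smul_apply, withDensity_apply _ MeasurableSet.univ, Measure.restrict_univ, hlint, smul_eq_mul,
      ENNReal.inv_mul_cancel hZne ENNReal.ofReal_ne_top]
  have hνint : ∀ G : GaugeField P j (Matrix.specialUnitaryGroup (Fin N) ℂ) → ℝ,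
      ∫ U, G U ∂ν = Z⁻¹ * ∫ U, G U * f U ∂μ := by
    intro G
    rw [hν, integral_smul_measure, integral_withDensity_eq_integral_toReal_smul hFdm
      (ae_of_all _ fun _ => ENNReal.ofReal_lt_top), ENNReal.toReal_inv, ENNReal.toReal_ofReal hZ0, smul_eq_mul]
    congr 1
    exact integral_congr_ae (ae_of_all _ fun U => by
      simp only [hFd, ENNReal.toReal_ofReal (hf0 U), smul_eq_mul, mul_comm])
  -- the moment hypothesis in `ν`'s currency
  have hLSν : ∀ a : ℝ, 0 ≤ a → a ≤ a₀ → ∀ X : Finset (Plaq P j),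
      ∫ U, Real.exp (a * β * ∑ q ∈ X, (1 - reTr (GaugeField.plaqHol U q))) ∂ν ≤ Real.exp (C * a * X.card) := by
    intro a ha0 ha X
    rw [hνint]
    calc Z⁻¹ * ∫ U, Real.exp (a * β * ∑ q ∈ X, (1 - reTr (GaugeField.plaqHol U q))) * f U ∂μ
        ≤ Z⁻¹ * (Real.exp (C * a * X.card) * Z) :=
          mul_le_mul_of_nonneg_left (hLS a ha0 ha X) (inv_nonneg.2 hZ0)
      _ = Real.exp (C * a * X.card) := by field_simp
  -- n20-d's transfer rule under `ν`
  have hP := measureReal_largeFieldCells_avgFun_le_of_moments (n := Fin N) hj hα hguard ν hβ hC hLSν hδ0 hδ ε D R m hm hdisj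
  -- back to the `f`-mass
  have hreal : ν.real S = Z⁻¹ * ∫ U in S, f U ∂μ := by
    rw [← integral_indicator_one hSm, hνint, ← integral_indicator hSm]
    congr 1
    refine integral_congr_ae (ae_of_all _ fun U => ?_)
    show S.indicator 1 U * f U = S.indicator f U
    by_cases hU : U ∈ S
    · simp only [Set.indicator_of_mem hU, Pi.one_apply, one_mul]
    · simp only [Set.indicator_of_notMem hU, zero_mul]
  have hmain : Z⁻¹ * ∫ U in S, f U ∂μ ≤ r := by rw [← hreal]; exact hP
  calc ∫ U in S, f U ∂μ = Z * (Z⁻¹ * ∫ U in S, f U ∂μ) := by field_simp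
    _ ≤ Z * r := mul_le_mul_of_nonneg_left hmain hZ0
    _ = r * Z := mul_comm _ _

end State

/-! ## §2 At the record: «LCS-j» in the old term's state ⇒ the pinned (3.2) families' «hrel» at step j -/

section Record

variable (F : T4Family) (N : ℕ) [NeZero N] (ν : Stage7Numerics) (M : ℕ) (p : B12.RunParams) (g : ℕ → ℝ)

/-- **THE TWO LOCATED HALVES COMPOSE AT EVERY LEVEL.**  At a performed step `k` (`k < K`) of the run on the torus `F.P K`, let `f ≥ 0` be the
(measurable, integrable) pinned fine density of an old history term on the level-`k` fields, and suppose «LCS-k» holds in ITS OWN STATE in the moment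
form the (α)-road names (`Spine/NE7b/LocalConditionalStability.LocCondStability` with exponential plaquette-energy carriers — for `k = 0` module 7's
`lcs_rhoZeroOfRecord`, for the all-plaquette-restricted level-`0` state module 13's `condLCS_boltzmann`; at `k ≥ 1` THE located residual, (A1c)):
`∫ e^{aβΣ_{q∈X}(1 − reTr U(∂q))}·f dU ≤ e^{C·a·#X}·∫ f dU` (`0 ≤ a ≤ a₀`).  Then, modulo `IsZetaAbsLeOne` and the regularity letters of the pinned cubes
(pairwise disjoint regions `R c` of at most `m` level-`(k+1)` plaquettes, common size threshold `ε″ ≥ 0`), the labels of NODE 00's step weights of record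
whose new large-field family contains `D` weigh, against `f` on the graph `V′ = Ū`, at most ONE PEIERLS FACTOR PER PINNED CUBE times the term's mass:
`|∫ (Σ_{t : D ⊆ P(t)} ω s t (U,Ū))·f dU| ≤ (m·e^{C·A·M·M·δ − δβ·ε″²∕(2N)})^{#D} · ∫ f dU`
(`A`, `M` n20-d's constants, `δ` its tilt under the guard `α`).  What the (A1c) instance owes at `j ≥ 1` for the (3.2)-pinned labels is therefore EXACTLY
the moment form of «LCS-j» for the term's fine density — nothing else. [folklore] -/
theorem abs_integral_pinnedLargeFamily_le_of_moments (k : ℕ) (hk : k < p.K) {α : ℝ} (hα : 0 < α)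
    (hguard : (((((F.P p.K).d + 2) * (F.P p.K).L : ℕ) : ℝ) ^ 2 / 4) * Real.sqrt (2 * (Fintype.card (Fin N) : ℝ) * α) <
      deltaSU (Fin N))
    (A₁ : ℝ) {ζ : ZetaOfRecord F N ν M} (hζ : IsZetaAbsLeOne F N ν M ζ) (s : SeqOfRecord F ν M g p.K k)
    {f : GaugeField (F.P p.K) k (SU N) → ℝ} (hfm : Measurable f) (hf0 : ∀ U, 0 ≤ f U)
    (hf : Integrable f (fieldMeasure (F.P p.K) k (SU N))) {β : ℝ} (hβ : 0 ≤ β) {C a₀ : ℝ} (hC : 0 ≤ C)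
    (hLS : ∀ a : ℝ, 0 ≤ a → a ≤ a₀ → ∀ X : Finset (Plaq (F.P p.K) k),
      ∫ U, Real.exp (a * β * ∑ q ∈ X, (1 - reTr (GaugeField.plaqHol U q))) * f U ∂(fieldMeasure (F.P p.K) k (SU N)) ≤
        Real.exp (C * a * X.card) * ∫ U, f U ∂(fieldMeasure (F.P p.K) k (SU N)))
    {δ : ℝ} (hδ0 : 0 ≤ δ)
    (hδ : δ * ((2 * (Fintype.card (Fin N) : ℝ) * (((F.P p.K).L : ℝ) ^ 2 + 6 * ((((F.P p.K).d + 2) * (F.P p.K).L : ℕ) : ℝ) ^ 2) ^ 2 + 2 / α) *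
      (((2 * (((F.P p.K).d + 3) * (F.P p.K).L + 2) + 1) ^ (F.P p.K).d * (F.P p.K).d ^ 2 : ℕ) : ℝ)) ≤ a₀)
    (D : Finset (Iχ F ν p g k)) (R : Iχ F ν p g k → Finset (Plaq (F.P p.K) (k + 1))) (m : ℕ) {ε'' : ℝ} (hε : 0 ≤ ε'')
    (hm : ∀ c ∈ D, (R c).card ≤ m) (hdisj : ∀ c₁ ∈ D, ∀ c₂ ∈ D, c₁ ≠ c₂ → Disjoint (R c₁) (R c₂))
    (hreg : ∀ c ∈ D, ∀ V' : GaugeField (F.P p.K) (k + 1) (SU N),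
      (∀ p' ∈ R c, dist1 (GaugeField.plaqHol V' p') < ε'') → chiFactor F N ν p g k c V' = 1) :
    |∫ U, (∑ t ∈ Finset.univ.filter (fun t : LbOfRecord F ν p g k => D ⊆ t.1),
        ωOfRecord F N ν M p g k A₁ ζ s t U ((avOfRecord F N p.K k).avg U)) * f U ∂(fieldMeasure (F.P p.K) k (SU N))| ≤
      ((m : ℝ) * Real.exp (C * ((2 * (Fintype.card (Fin N) : ℝ) *
            (((F.P p.K).L : ℝ) ^ 2 + 6 * ((((F.P p.K).d + 2) * (F.P p.K).L : ℕ) : ℝ) ^ 2) ^ 2 + 2 / α) *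
          (((2 * (((F.P p.K).d + 3) * (F.P p.K).L + 2) + 1) ^ (F.P p.K).d * (F.P p.K).d ^ 2 : ℕ) : ℝ)) *
          (((2 * (((F.P p.K).d + 3) * (F.P p.K).L + 2) + 1) ^ (F.P p.K).d * (F.P p.K).d ^ 2 : ℕ) : ℝ) * δ -
            δ * β * (ε'' ^ 2 / (2 * (Fintype.card (Fin N) : ℝ))))) ^ D.card *
        ∫ U, f U ∂(fieldMeasure (F.P p.K) k (SU N)) := by
  classical
  have hj : k + 1 ≤ (F.P p.K).m + (F.P p.K).K := by
    simp only [T4Family.P_m, T4Family.P_K]; omega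
  -- step 1: module 19 on the graph
  have h1 := abs_integral_sum_ωOfRecord_filter_superset_mul_le F N ν M p g k A₁ hζ s D R ε'' hreg hf0 hf
  -- step 2: the size event lies in the energy event at threshold `ε″²∕(2N)`
  set S : Set (GaugeField (F.P p.K) k (SU N)) :=
    {U | ∀ c ∈ D, ∃ p' ∈ R c, ε'' ≤ dist1 (GaugeField.plaqHol ((avOfRecord F N p.K k).avg U) p')} with hS
  set S' : Set (GaugeField (F.P p.K) k (SU N)) :=
    {U | ∀ c ∈ D, ∃ p' ∈ R c, ε'' ^ 2 / (2 * (Fintype.card (Fin N) : ℝ)) ≤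
      1 - reTr (GaugeField.plaqHol (avgFun (expMeanLogSU (n := Fin N)) U) p')} with hS'
  have hsub : S ⊆ S' := by
    intro U hU c hc
    obtain ⟨p', hp', hle⟩ := hU c hc
    exact ⟨p', hp', sq_div_le_one_sub_reTr_of_le_dist1 _ hε hle⟩
  have h2 : ∫ U in S, f U ∂(fieldMeasure (F.P p.K) k (SU N)) ≤ ∫ U in S', f U ∂(fieldMeasure (F.P p.K) k (SU N)) :=
    setIntegral_mono_set hf.integrableOn (ae_of_all _ hf0) (ae_of_all _ hsub)
  -- step 3: the moments of the state `f`
  have h3 := setIntegral_forall_exists_le_of_moments (N := N) hj hα hguard hfm hf0 hf hβ hC hLS hδ0 hδ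
    (ε'' ^ 2 / (2 * (Fintype.card (Fin N) : ℝ))) D R m hm hdisj
  exact h1.trans (h2.trans h3)

end Record

/-! ## §3 In the tower's currency: the level-(k+1) masses of the pinned label pieces from «LCS-k» -/

section Tower

variable (F : T4Family) (N : ℕ) [NeZero N] (ν : Stage7Numerics) (M : ℕ) (p : B12.RunParams) (g : ℕ → ℝ)

/-- **«hrel» AT ANY PINNED STEP, IN THE TOWER's CURRENCY, FROM «LCS-k» IN THE OLD TERM's STATE.**  At a performed step `k < K`, for an old slot `T(s) ≥ 0`
with measurable, integrable pinned fine density `f = χ_k(s)·T(s)` obeying the moment form of «LCS-k» (`hLS`), modulo `IsZetaAbsLeOne`, the regularity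
letters (disjoint regions `R c`, `≤ m` plaquettes each, size threshold `ε″ ≥ 0`) and the displayed measurabilities of the label weights and new front
factors: the SUM OVER THE PINNED LABEL CHOICES `t` (`D ⊆ P(t)`) OF THE LEVEL-`(k+1)` MASSES OF THEIR 𝐓-PIECES is at most
`(m·e^{C·A·M·M·δ − δβ·ε″²∕(2N)})^{#D}` times the old piece's level-`k` mass — `PrefixExtraction.hrel_of_hstep`'s conclusion shape at level `k` for
label-indexed choices, CONDITIONAL on the located residual «LCS-k» (module 21's `integral_labelPiece` + §2). [folklore] -/
theorem abs_sum_integral_pinnedLabelPieces_le_of_moments (k : ℕ) (hk : k < p.K) {α : ℝ} (hα : 0 < α)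
    (hguard : (((((F.P p.K).d + 2) * (F.P p.K).L : ℕ) : ℝ) ^ 2 / 4) * Real.sqrt (2 * (Fintype.card (Fin N) : ℝ) * α) <
      deltaSU (Fin N))
    (A₁ : ℝ) {ζ : ZetaOfRecord F N ν M} (hζ : IsZetaAbsLeOne F N ν M ζ)
    (T : SeqOfRecord F ν M g p.K k → Density (F.P p.K) k (SU N)) (s : SeqOfRecord F ν M g p.K k)
    (hfm : Measurable (fun U => chiSeqOfRecord F N ν M g p.K k s U * T s U))
    (hf0 : ∀ U, 0 ≤ chiSeqOfRecord F N ν M g p.K k s U * T s U)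
    (hT : Integrable (fun U => chiSeqOfRecord F N ν M g p.K k s U * T s U) (fieldMeasure (F.P p.K) k (SU N)))
    {β : ℝ} (hβ : 0 ≤ β) {C a₀ : ℝ} (hC : 0 ≤ C)
    (hLS : ∀ a : ℝ, 0 ≤ a → a ≤ a₀ → ∀ X : Finset (Plaq (F.P p.K) k),
      ∫ U, Real.exp (a * β * ∑ q ∈ X, (1 - reTr (GaugeField.plaqHol U q))) * (chiSeqOfRecord F N ν M g p.K k s U * T s U)
          ∂(fieldMeasure (F.P p.K) k (SU N)) ≤
        Real.exp (C * a * X.card) * ∫ U, chiSeqOfRecord F N ν M g p.K k s U * T s U ∂(fieldMeasure (F.P p.K) k (SU N)))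
    {δ : ℝ} (hδ0 : 0 ≤ δ)
    (hδ : δ * ((2 * (Fintype.card (Fin N) : ℝ) * (((F.P p.K).L : ℝ) ^ 2 + 6 * ((((F.P p.K).d + 2) * (F.P p.K).L : ℕ) : ℝ) ^ 2) ^ 2 + 2 / α) *
      (((2 * (((F.P p.K).d + 3) * (F.P p.K).L + 2) + 1) ^ (F.P p.K).d * (F.P p.K).d ^ 2 : ℕ) : ℝ)) ≤ a₀)
    (D : Finset (Iχ F ν p g k)) (R : Iχ F ν p g k → Finset (Plaq (F.P p.K) (k + 1))) (m : ℕ) {ε'' : ℝ} (hε : 0 ≤ ε'')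
    (hm : ∀ c ∈ D, (R c).card ≤ m) (hdisj : ∀ c₁ ∈ D, ∀ c₂ ∈ D, c₁ ≠ c₂ → Disjoint (R c₁) (R c₂))
    (hreg : ∀ c ∈ D, ∀ V' : GaugeField (F.P p.K) (k + 1) (SU N),
      (∀ p' ∈ R c, dist1 (GaugeField.plaqHol V' p') < ε'') → chiFactor F N ν p g k c V' = 1)
    (hω : ∀ t : LbOfRecord F ν p g k, Measurable (fun z : GaugeField (F.P p.K) (k + 1) (SU N) × GaugeField (F.P p.K) k (SU N) =>
      ωOfRecord F N ν M p g k A₁ ζ s t z.2 z.1))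
    (hχ : ∀ t : LbOfRecord F ν p g k, Measurable (chiSeqOfRecord F N ν M g p.K (k + 1) (σOfRecord F ν M p g k s t))) :
    |∑ t ∈ Finset.univ.filter (fun t : LbOfRecord F ν p g k => D ⊆ t.1),
        ∫ V', chiSeqOfRecord F N ν M g p.K (k + 1) (σOfRecord F ν M p g k s t) V' *
          texpASucc (avOfRecord F N p.K k).avg (chiSeqOfRecord F N ν M g p.K k) T
            (fun _ => ωOfRecord F N ν M p g k A₁ ζ s t) (σOfRecord F ν M p g k s t) V' ∂(fieldMeasure (F.P p.K) (k + 1) (SU N))| ≤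
      ((m : ℝ) * Real.exp (C * ((2 * (Fintype.card (Fin N) : ℝ) *
            (((F.P p.K).L : ℝ) ^ 2 + 6 * ((((F.P p.K).d + 2) * (F.P p.K).L : ℕ) : ℝ) ^ 2) ^ 2 + 2 / α) *
          (((2 * (((F.P p.K).d + 3) * (F.P p.K).L + 2) + 1) ^ (F.P p.K).d * (F.P p.K).d ^ 2 : ℕ) : ℝ)) *
          (((2 * (((F.P p.K).d + 3) * (F.P p.K).L + 2) + 1) ^ (F.P p.K).d * (F.P p.K).d ^ 2 : ℕ) : ℝ) * δ -
            δ * β * (ε'' ^ 2 / (2 * (Fintype.card (Fin N) : ℝ))))) ^ D.card *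
        ∫ U, chiSeqOfRecord F N ν M g p.K k s U * T s U ∂(fieldMeasure (F.P p.K) k (SU N)) := by
  rw [Finset.sum_congr rfl fun t _ => integral_labelPiece F N ν M p g k hk A₁ hζ T s t hT (hω t) (hχ t),
    ← integral_finsetSum _ fun t _ => integrable_labelFine F N ν M p g k A₁ hζ T s t hT (hω t)]
  have hsum : ∀ U, ∑ t ∈ Finset.univ.filter (fun t : LbOfRecord F ν p g k => D ⊆ t.1),
      ωOfRecord F N ν M p g k A₁ ζ s t U ((avOfRecord F N p.K k).avg U) * (chiSeqOfRecord F N ν M g p.K k s U * T s U) =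
        (∑ t ∈ Finset.univ.filter (fun t : LbOfRecord F ν p g k => D ⊆ t.1),
          ωOfRecord F N ν M p g k A₁ ζ s t U ((avOfRecord F N p.K k).avg U)) * (chiSeqOfRecord F N ν M g p.K k s U * T s U) :=
    fun U => (Finset.sum_mul _ _ _).symm
  rw [integral_congr_ae (ae_of_all _ hsum)]
  exact abs_integral_pinnedLargeFamily_le_of_moments F N ν M p g k hk hα hguard A₁ hζ s hfm hf0 hT hβ hC hLS hδ0 hδ D R m hε
    hm hdisj hreg

end Tower

end Summit.QuantumFields.YangMills.BalabanUVNodes.N20LCSLargeFieldOfMoments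

end

/-! ### Erratum (g4, 2026-08-27) — citation pointer, prose only
In the prose of this file «[Balaban1985PropagatorsII] Thm 1» ∕ «CMP 99 (1985) 389–434» denotes T. Bałaban, *The variational problem and
background fields in renormalization group method for lattice gauge theories*, Commun. Math. Phys. **102** (1985) 277–309 — bib key
`Balaban1985Variational` —, Theorem 1 p. 279 (for data with `|∂V(p′) − 1| < ε₁ ≤ a₁` there is a minimal orbit in
`U_k({𝔅_j}, B₃ε₁) ∩ 𝔘_k(𝔅_k, V)`, the unique critical orbit for `B₃ε₁ ≤ ε₀ ≤ a₀`, with the local regularity (9)–(10)); there is no bib key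
`Balaban1985PropagatorsII`.  The regularity letter `hreg` is that theorem's shape at def-R's (2.16) problem.  Statements are unaffected. -/
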